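import Summits.QuantumFields.YangMills.Theorems.BalabanUVNodesN12NearFlatFederbushFibreTwisted
import Literature.MathematicalPhysics.QuantumFieldTheory.Balaban1983to89.B16Ineq17NearFlatWilsonLettersWindow

/-!
# BalabanUVNodes ∕ N12 — THE FEDERBUSH FIBRE LETTER `hm` AGAINST THE WINDOW FLAT FORM `B_W`: the producers of this seat's chain (p602396 → p603788 → p604917 → p611770)
# re-read with the weight `ζ := 𝟙_{S_0}` in g0's localized Federbush chain — `γ₀·circ(X) ≤ B_W w′ w′` for every window `W ⊇ {q | q.src ∈ S_0}`, the far plaquettes never added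

Cell `pub-ymgap` (HUMAN RULINGS D-0062 ∕ D-0149), width seat `pub-ymgap-dag-n12-w4` g5; the lane owner's question (dag-n12-c g20 WORD-2 (3), 2026-08-28): «name the PRODUCER edition —
today's `hm` producers conclude against the FULL flat second variation; the window socket needs `m ≤ B_W w′ w′` with the Local-Federbush box plaquettes `⊆ W`».  Key K1⁹
`stmt-QuantumFields-27364`, `--kind proof --supports … --as helper`; count-neutral; THEOREMS ONLY (0 `def`, 0 `sorry`, 0 `instance`).  CONSUMED BY NAME, nothing restated: g0's
`B16Ineq17FlatRouteConstants.gamma0_circ_le_of_flat_chain` (p591325 — ALREADY weighted by a site weight `ζ ≥ 0`, `ζ ≥ 1` on `S_0`; p602396 took `ζ ≡ 1`), this seat's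
`…N12NearFlatFederbushFibre.exists_su2ReCoord` ∕ `lieSU2Coord_reCoord_eq` (p602396), `…FibreChart.reproduce_of_fderiv_msChart_one_eq` (p603788), `…FibreRecord.hcons_of_plaqsInside_maxDomT`
(p604917), `…FibreTwisted.exists_rotE3_of_lieSU2Coord` ∕ `exists_twistSlice` ∕ `twistSlice_close` (p611770), `B16Ineq17NearFlatWilsonLettersWindow.flatFormOn_apply_self` (this seat, the window
form `B_W` as an inline continuous bilinear map — the SAME term the window skeleton `hessian_wilsonAction4_criticalExpChartFamily_ge_flatMin_sub_window` and dag-n12-c's junction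
`B15Prop1EndpointNearFlatLettersWindow` read), dag-n12-w3's `B16Ineq19FlatSliceChart.norm_sq_lieSU2Coord` (`‖φ v‖² = 2‖v‖²`), dag-n10-w1's (J-b) A∕B (`chainLaw_iterLin_comp_linearMap`,
`oc_iterLin_comp_eq_of_reproduce`), `B16Ineq17NearFlatDatumFamily.fderiv_msChart_comp_apply_top_of_isMinimizer_family` ((β3)), `B16Ineq17SliceTwist.circ_twist_ge_sub` ((T)).

THE PRINT.  [Balaban1989LargeFieldII] p. 357 foot – p. 358 (1.7): «Using the bound (1.67) [10] for this form, we obtain ⟨H_{1,k}B′, Δ₁(ζ₀)H_{1,k}B′⟩ ≧ γ₀ Σ_{c⊂B^k(Λ₀)}|(∂^{L^{−k}}Q_kH_{1,k}B′)(c)|²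
− …» — the lower bound is a sum over the WINDOW `B^k(Λ₀)`; [Federbush1986PhaseCellI] 'Abelian Stability Theorem' (0.12) p. 321 («averaging decreases the action», block by block);
[Balaban1984PropagatorsI] (1.64)–(1.67) p. 29; [Balaban1985Variational] (45) p. 285.

CONTENTS.  `B_W(u,v) := (1∕2)·Σ_{p∈W}⟪σ⁰_p u, σ⁰_p v⟫` (Hilbert–Schmidt on `𝔰𝔲(2)`; `σ⁰_p u = u_{b₁}+u_{b₂}−u_{b₃}−u_{b₄}`), written inline exactly as in `B16Ineq17NearFlatWilsonLettersWindow`.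
§1 ★★★ `gamma0_circ_le_flatFormOn_of_reproduce` — p602396's fibre letter VERBATIM + `(W, hW : ∀ q, q.src ∈ S_0 → q ∈ W)`, conclusion `((L^d)^k∕(L²L²)^k)·circ(X) ≤ B_W w′ w′`
   (`B_W w′ w′ = Σ_{p∈W}‖oc(ψ∘w′) p‖²` by `flatFormOn_apply_self` + `norm_sq_lieSU2Coord`; weight `𝟙_{S_0}`; `Finset.sum_le_sum_of_subset_of_nonneg`; in `d = 4` the ratio is `1`, g0's `gamma0_raw_dim4`);
   ★★ `hm_federbush_window_of_reproduce` (binder shape).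
§2 ★★ `hm_federbush_window_of_fderiv_msChart_one_eq` (p603788 twin: from `DΦ♭(0) w′ = y`), ★★ `hm_federbush_window_atBj_of_fderiv_msChart_one_eq` (p604917 twin: at `𝐁_k(Z)`, placement letter `hΩk`).
§3 ★★★ `hm_federbush_atBj_twisted_window_of_isMinimizer_family` (p611770 §3 twin: the curved chart of record through the twist, `γ₀·(circ X − 16(d+1)τ‖X‖²) ≤ B_W w′ w′`),
   ★★ `exists_m_hm_twisted_windowForm_of_isMinimizer_family` (the J-C clause `∃ m, (∀ w′, Lf w′ = DΨ(0)(X_f′X) → m ≤ B_W w′ w′) ∧ γ₀·circ X − γ₀·16(d+1)τ‖X‖² ≤ m` — the socket a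
   (C1′) re-key would read; the region letters `(Q, S_i, hwin, hS, hΩk)` stay DISPLAYED here: p611770's knit discharge `S_i := univ` below level `k` would force `W = univ`, the tight
   discharge is the block tower of the window — sequel `…FibreWindowKnit`).

HONEST FRAMING.  Junction algebra BY NAME over landed kernel theorems + one weight choice; per-height raw-unit `γ₀`, NOT print's volume-uniform constants; nothing of Bałaban's (1.7) ∕
(1.65)–(1.67) ∕ Prop. 1 asserted beyond these kernel inequalities; N12 NOT discharged; K1⁹ NOT closed; count-neutral (typed 28∕28 · discharged 5∕27 unmoved); one finite 𝕋⁴ programme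
at fixed ε — R4 closes the conditional rung `BalabanLadder.UV` only; the YM mass gap (Clay) is NOT proved by any of this.  No `sorry`, no `def`, no `instance`, no `notation`.
-/

noncomputable section

open scoped BigOperators Matrix.Norms.L2Operator InnerProductSpace
open Filter Topology Finset

namespace Summit.QuantumFields.YangMills.BalabanUVNodes.N12NearFlatFederbushFibreWindow

open Literature.MathematicalPhysics.QuantumFieldTheory.Balaban1983to89
open Literature.MathematicalPhysics.QuantumLattice (quatMatrix)
open T4Continuum (T4Family)
open T4HaarSU2ExpChart (imQuat imQuat_apply norm_imQuat)
open T4QuatExpLog (norm_quatMatrix)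
open T4AdjointCovarianceUnitary (lieSU mem_lieSU_iff specialUnitaryAd)
open T4CubeChartGnomonic (SU2)
open B15Prop1ChartSU2 (su2Chart)
open B16Sect1Backgrounds (expMul)
open B15DeterminingSets GaugeField
open B14.Eq213DetSet (Bj maxDomT)
open B15Prop1SliceCoordinates (GaugeSlice ιA freeBonds ιA_apply_of_mem ιA_apply_of_not_mem)
open T4AxialGaugeSmallField (castSite)
open B6TreeGaugePoincare (curl)
open B16Eq18Proof (box)
open LatticeFieldCalculus (bondAvg runSite)
open B6StairStokesTorus (oc)
open B16Ineq19FlatSliceChart (exists_lieSU2Coord expMul_su2Chart_smul_one_eq_expChart norm_sq_lieSU2Coord)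
open B16Ineq17FlatRouteConstants (gamma0_circ_le_of_flat_chain gamma0_raw_dim4)
open BlockAveragingEMLLinearised (linAvg)
open Literature.MathematicalPhysics.QuantumFieldTheory.BalabanImbrieJaffe1984to88.BIJ85Eq453GaugeField (qsstarGIter0)
open Node00
open B16Ineq17NearFlatWilsonLettersWindow (flatFormOn_apply_self)
open B16Ineq17NearFlatDatumFamily (fderiv_msChart_comp_apply_top_of_isMinimizer_family)
open B16Ineq17SliceTwist (circ_twist_ge_sub)
open Summit.QuantumFields.YangMills.BalabanUVNodes.N12FlatConstraintPlaquetteJunction (chainLaw_iterLin_comp_linearMap oc_iterLin_comp_eq_of_reproduce)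
open Summit.QuantumFields.YangMills.BalabanUVNodes.N12NearFlatFederbushFibre (exists_su2ReCoord lieSU2Coord_reCoord_eq)
open Summit.QuantumFields.YangMills.BalabanUVNodes.N12NearFlatFederbushFibreChart (reproduce_of_fderiv_msChart_one_eq)
open Summit.QuantumFields.YangMills.BalabanUVNodes.N12NearFlatFederbushFibreRecord (hcons_of_plaqsInside_maxDomT)
open Summit.QuantumFields.YangMills.BalabanUVNodes.N12NearFlatFederbushFibreTwisted (exists_rotE3_of_lieSU2Coord exists_twistSlice twistSlice_close)

/-! ## §1  The fibre letter against the window form -/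

section Fibre

variable {P : Params} {k : ℕ} [DecidableEq (PBond P k)]

/-- ★★★ **THE FEDERBUSH FIBRE LETTER AGAINST THE WINDOW FORM** — p602396's `gamma0_circ_le_secondVariation_flat_of_reproduce` with the SAME data plus a finite set `W` of fine
plaquettes containing every plaquette SOURCED in the finest region `S_0`: `((L^d)^k∕(L²L²)^k)·circ(X) ≤ B_W w′ w′` — g0's localized Federbush chain with the weight `ζ := 𝟙_{S_0}`
(`ζ ≥ 1` is asked on `S_0` only), the far plaquettes never added; `B_W w′ w′ = Σ_{p∈W}‖oc(ψ∘w′) p‖²` (`‖φ v‖² = 2‖v‖²`).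
[cite: Balaban1989LargeFieldII, (1.7) pp.357–358; Balaban1984PropagatorsI, (1.64)–(1.67) p.29; Federbush1986PhaseCellI, 'Abelian Stability Theorem' (0.12) p.321; Balaban1985Variational, (45) p.285] -/
theorem gamma0_circ_le_flatFormOn_of_reproduce (h0 : 0 < P.d) (hk : k ≤ P.m + P.K) {S : Set (Site P k)} {T : Finset (PBond P k)}
    (X : GaugeSlice S T (EuclideanSpace ℝ (Fin 3))) {m : Fin P.d → ℕ} (lo : Fin P.d → ℤ) (hm : ∀ κ, (m κ : ℤ) ≤ P.sitesPerDir k)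
    (Sset : (i : ℕ) → Finset (Site P i)) (hwin : ∀ z ∈ box m lo, (castSite z : Site P k) ∈ Sset k)
    (hS : ∀ (ν : Fin P.d), (⟨0, h0⟩ : Fin P.d) ≠ ν → ∀ i, i < k → ∀ y ∈ Sset (i + 1), ∀ (r : Fin P.d → Fin P.L) (s t : ℕ),
      s < P.L → t < P.L → runSite (runSite (Site.blockSite y r) ⟨0, h0⟩ s) ν t ∈ Sset i)
    (Q : (i : ℕ) → (PBond P 0 → Matrix (Fin 2) (Fin 2) ℂ) → PBond P i → Matrix (Fin 2) (Fin 2) ℂ) (hQ0 : ∀ Y, Q 0 Y = Y)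
    (hQs : ∀ (i : ℕ) (Y : PBond P 0 → Matrix (Fin 2) (Fin 2) ℂ) (c : PBond P (i + 1)), Q (i + 1) Y c = linAvg (Q i Y) c)
    {φ : EuclideanSpace ℝ (Fin 3) →ₗ[ℝ] lieSU (Fin 2)} (hφ : ∀ v, ((φ v : lieSU (Fin 2)) : Matrix (Fin 2) (Fin 2) ℂ) = quatMatrix (imQuat v))
    (W : Finset (Plaq P 0)) (hW : ∀ q : Plaq P 0, q.src ∈ Sset 0 → q ∈ W)
    (w' : PBond P 0 → lieSU (Fin 2))
    (hrep : ∀ (ν : Fin P.d), ∀ y ∈ Sset k,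
      Q k (fun b => (w' b : Matrix (Fin 2) (Fin 2) ℂ)) ⟨y, ⟨0, h0⟩⟩ = ((φ (ιA S T X ⟨y, ⟨0, h0⟩⟩) : lieSU (Fin 2)) : Matrix (Fin 2) (Fin 2) ℂ) ∧
      Q k (fun b => (w' b : Matrix (Fin 2) (Fin 2) ℂ)) ⟨y.shift ⟨0, h0⟩, ν⟩ = ((φ (ιA S T X ⟨y.shift ⟨0, h0⟩, ν⟩) : lieSU (Fin 2)) : Matrix (Fin 2) (Fin 2) ℂ) ∧
      Q k (fun b => (w' b : Matrix (Fin 2) (Fin 2) ℂ)) ⟨y.shift ν, ⟨0, h0⟩⟩ = ((φ (ιA S T X ⟨y.shift ν, ⟨0, h0⟩⟩) : lieSU (Fin 2)) : Matrix (Fin 2) (Fin 2) ℂ) ∧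
      Q k (fun b => (w' b : Matrix (Fin 2) (Fin 2) ℂ)) ⟨y, ν⟩ = ((φ (ιA S T X ⟨y, ν⟩) : lieSU (Fin 2)) : Matrix (Fin 2) (Fin 2) ℂ)) :
    ((P.L : ℝ) ^ P.d) ^ k / (((P.L : ℝ)) ^ 2 * (P.L : ℝ) ^ 2) ^ k *
        ∑ z ∈ box m lo, ∑ μ : Fin P.d, ∑ a : Fin 3, curl (fun b => ιA S T X (⟨castSite b.1, b.2⟩ : PBond P k) a) z ⟨0, h0⟩ μ ^ 2
      ≤ ((Fintype.card (Fin 2) : ℝ)⁻¹ • ∑ p ∈ W, (innerSL ℝ (E := lieSU (Fin 2))).bilinearComp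
          (ContinuousLinearMap.proj (R := ℝ) (φ := fun _ : PBond P 0 => lieSU (Fin 2)) (⟨p.src, p.μ⟩ : PBond P 0) + ContinuousLinearMap.proj (R := ℝ) (φ := fun _ : PBond P 0 => lieSU (Fin 2)) (⟨p.src.shift p.μ, p.ν⟩ : PBond P 0)
            - ContinuousLinearMap.proj (R := ℝ) (φ := fun _ : PBond P 0 => lieSU (Fin 2)) (⟨p.src.shift p.ν, p.μ⟩ : PBond P 0) - ContinuousLinearMap.proj (R := ℝ) (φ := fun _ : PBond P 0 => lieSU (Fin 2)) (⟨p.src, p.ν⟩ : PBond P 0) : (PBond P 0 → lieSU (Fin 2)) →L[ℝ] lieSU (Fin 2))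
          (ContinuousLinearMap.proj (R := ℝ) (φ := fun _ : PBond P 0 => lieSU (Fin 2)) (⟨p.src, p.μ⟩ : PBond P 0) + ContinuousLinearMap.proj (R := ℝ) (φ := fun _ : PBond P 0 => lieSU (Fin 2)) (⟨p.src.shift p.μ, p.ν⟩ : PBond P 0)
            - ContinuousLinearMap.proj (R := ℝ) (φ := fun _ : PBond P 0 => lieSU (Fin 2)) (⟨p.src.shift p.ν, p.μ⟩ : PBond P 0) - ContinuousLinearMap.proj (R := ℝ) (φ := fun _ : PBond P 0 => lieSU (Fin 2)) (⟨p.src, p.ν⟩ : PBond P 0) : (PBond P 0 → lieSU (Fin 2)) →L[ℝ] lieSU (Fin 2))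
          : (PBond P 0 → lieSU (Fin 2)) →L[ℝ] (PBond P 0 → lieSU (Fin 2)) →L[ℝ] ℝ) w' w' := by
  classical
  obtain ⟨ψ, hψv, hψZ⟩ := exists_su2ReCoord
  -- the `ℝ³`-valued chain `Y_i := ψ ∘ Q^{(i)} w′` (as in p602396)
  set A : PBond P 0 → Matrix (Fin 2) (Fin 2) ℂ := fun b => (w' b : Matrix (Fin 2) (Fin 2) ℂ) with hA
  set Y : (i : ℕ) → VecField P i (EuclideanSpace ℝ (Fin 3)) := fun i b => ψ (Q i A b) with hY
  have hL : (P.L : ℝ) ≠ 0 := by exact_mod_cast P.L_pos.ne'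
  have hchain : ∀ (ν : Fin P.d), (⟨0, h0⟩ : Fin P.d) ≠ ν → ∀ i, i < k → ∀ y ∈ Sset (i + 1),
      oc (Y (i + 1)) ⟨0, h0⟩ ν y = (P.L : ℝ) • oc (bondAvg (Y i)) ⟨0, h0⟩ ν y :=
    fun ν _ i _ y _ => chainLaw_iterLin_comp_linearMap Q hQs ψ A i ⟨0, h0⟩ ν y
  have hψφ : ∀ v : EuclideanSpace ℝ (Fin 3), ψ (((φ v : lieSU (Fin 2)) : Matrix (Fin 2) (Fin 2) ℂ)) = v := fun v => by rw [hφ, hψv]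
  have htop : ∀ (ν : Fin P.d), ∀ y ∈ Sset k, oc (Y k) ⟨0, h0⟩ ν y = oc (ιA S T X) ⟨0, h0⟩ ν y := by
    intro ν y hy
    obtain ⟨h1, h2, h3, h4⟩ := hrep ν y hy
    have h := oc_iterLin_comp_eq_of_reproduce Q ψ A (fun b => ((φ (ιA S T X b) : lieSU (Fin 2)) : Matrix (Fin 2) (Fin 2) ℂ)) ⟨0, h0⟩ ν y h1 h2 h3 h4
    rw [hY]
    simp only at h ⊢
    rw [h]
    simp only [oc, hψφ]
  have hw' : ∀ b, φ (Y 0 b) = w' b := fun b => by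
    rw [hY]
    simp only [hQ0, hA]
    exact lieSU2Coord_reCoord_eq hφ hψZ (w' b)
  -- the window form at `w′` in `oc` currency: `B_W w′ w′ = Σ_{p ∈ W} ‖oc (Y 0) p‖²`
  have hBW : ((Fintype.card (Fin 2) : ℝ)⁻¹ • ∑ p ∈ W, (innerSL ℝ (E := lieSU (Fin 2))).bilinearComp
        (ContinuousLinearMap.proj (R := ℝ) (φ := fun _ : PBond P 0 => lieSU (Fin 2)) (⟨p.src, p.μ⟩ : PBond P 0) + ContinuousLinearMap.proj (R := ℝ) (φ := fun _ : PBond P 0 => lieSU (Fin 2)) (⟨p.src.shift p.μ, p.ν⟩ : PBond P 0)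
          - ContinuousLinearMap.proj (R := ℝ) (φ := fun _ : PBond P 0 => lieSU (Fin 2)) (⟨p.src.shift p.ν, p.μ⟩ : PBond P 0) - ContinuousLinearMap.proj (R := ℝ) (φ := fun _ : PBond P 0 => lieSU (Fin 2)) (⟨p.src, p.ν⟩ : PBond P 0) : (PBond P 0 → lieSU (Fin 2)) →L[ℝ] lieSU (Fin 2))
        (ContinuousLinearMap.proj (R := ℝ) (φ := fun _ : PBond P 0 => lieSU (Fin 2)) (⟨p.src, p.μ⟩ : PBond P 0) + ContinuousLinearMap.proj (R := ℝ) (φ := fun _ : PBond P 0 => lieSU (Fin 2)) (⟨p.src.shift p.μ, p.ν⟩ : PBond P 0)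
          - ContinuousLinearMap.proj (R := ℝ) (φ := fun _ : PBond P 0 => lieSU (Fin 2)) (⟨p.src.shift p.ν, p.μ⟩ : PBond P 0) - ContinuousLinearMap.proj (R := ℝ) (φ := fun _ : PBond P 0 => lieSU (Fin 2)) (⟨p.src, p.ν⟩ : PBond P 0) : (PBond P 0 → lieSU (Fin 2)) →L[ℝ] lieSU (Fin 2))
        : (PBond P 0 → lieSU (Fin 2)) →L[ℝ] (PBond P 0 → lieSU (Fin 2)) →L[ℝ] ℝ) w' w'
      = ∑ p ∈ W, ‖oc (Y 0) p.μ p.ν p.src‖ ^ 2 := by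
    rw [flatFormOn_apply_self]
    have hcomb : ∀ p : Plaq P 0,
        ‖w' ⟨p.src, p.μ⟩ + w' ⟨p.src.shift p.μ, p.ν⟩ - w' ⟨p.src.shift p.ν, p.μ⟩ - w' ⟨p.src, p.ν⟩‖ ^ 2 = 2 * ‖oc (Y 0) p.μ p.ν p.src‖ ^ 2 := fun p => by
      rw [← hw', ← hw', ← hw', ← hw', ← map_add, ← map_sub, ← map_sub, norm_sq_lieSU2Coord hφ]
      rfl
    simp only [hcomb, ← Finset.mul_sum, Fintype.card_fin, Nat.cast_ofNat]
    ring
  -- the weight `ζ := 𝟙_{S_0}`: the far plaquettes are never added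
  have hflat : (2 : ℝ) / 2 * ∑ q : Plaq P 0, (fun x : Site P 0 => if x ∈ Sset 0 then (1 : ℝ) else 0) q.src * ‖oc (Y 0) q.μ q.ν q.src‖ ^ 2
      ≤ ((Fintype.card (Fin 2) : ℝ)⁻¹ • ∑ p ∈ W, (innerSL ℝ (E := lieSU (Fin 2))).bilinearComp
          (ContinuousLinearMap.proj (R := ℝ) (φ := fun _ : PBond P 0 => lieSU (Fin 2)) (⟨p.src, p.μ⟩ : PBond P 0) + ContinuousLinearMap.proj (R := ℝ) (φ := fun _ : PBond P 0 => lieSU (Fin 2)) (⟨p.src.shift p.μ, p.ν⟩ : PBond P 0)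
            - ContinuousLinearMap.proj (R := ℝ) (φ := fun _ : PBond P 0 => lieSU (Fin 2)) (⟨p.src.shift p.ν, p.μ⟩ : PBond P 0) - ContinuousLinearMap.proj (R := ℝ) (φ := fun _ : PBond P 0 => lieSU (Fin 2)) (⟨p.src, p.ν⟩ : PBond P 0) : (PBond P 0 → lieSU (Fin 2)) →L[ℝ] lieSU (Fin 2))
          (ContinuousLinearMap.proj (R := ℝ) (φ := fun _ : PBond P 0 => lieSU (Fin 2)) (⟨p.src, p.μ⟩ : PBond P 0) + ContinuousLinearMap.proj (R := ℝ) (φ := fun _ : PBond P 0 => lieSU (Fin 2)) (⟨p.src.shift p.μ, p.ν⟩ : PBond P 0)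
            - ContinuousLinearMap.proj (R := ℝ) (φ := fun _ : PBond P 0 => lieSU (Fin 2)) (⟨p.src.shift p.ν, p.μ⟩ : PBond P 0) - ContinuousLinearMap.proj (R := ℝ) (φ := fun _ : PBond P 0 => lieSU (Fin 2)) (⟨p.src, p.ν⟩ : PBond P 0) : (PBond P 0 → lieSU (Fin 2)) →L[ℝ] lieSU (Fin 2))
          : (PBond P 0 → lieSU (Fin 2)) →L[ℝ] (PBond P 0 → lieSU (Fin 2)) →L[ℝ] ℝ) w' w' := by
    rw [hBW, show (2 : ℝ) / 2 = 1 by norm_num, one_mul]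
    have hsub : Finset.univ.filter (fun q : Plaq P 0 => q.src ∈ Sset 0) ⊆ W := fun q hq => hW q (Finset.mem_filter.mp hq).2
    calc ∑ q : Plaq P 0, (fun x : Site P 0 => if x ∈ Sset 0 then (1 : ℝ) else 0) q.src * ‖oc (Y 0) q.μ q.ν q.src‖ ^ 2
        = ∑ q ∈ Finset.univ.filter (fun q : Plaq P 0 => q.src ∈ Sset 0), ‖oc (Y 0) q.μ q.ν q.src‖ ^ 2 := by
          rw [Finset.sum_filter]
          refine Finset.sum_congr rfl fun q _ => ?_
          show (if q.src ∈ Sset 0 then (1 : ℝ) else 0) * _ = _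
          by_cases hq : q.src ∈ Sset 0
          · rw [if_pos hq, if_pos hq, one_mul]
          · rw [if_neg hq, if_neg hq, zero_mul]
      _ ≤ ∑ p ∈ W, ‖oc (Y 0) p.μ p.ν p.src‖ ^ 2 := Finset.sum_le_sum_of_subset_of_nonneg hsub fun p _ _ => sq_nonneg _
  have h := gamma0_circ_le_of_flat_chain h0 hk X lo hm hL (by norm_num : (0 : ℝ) < 2) Y Sset hwin htop hS hchain
    (fun x : Site P 0 => if x ∈ Sset 0 then (1 : ℝ) else 0) (fun x => by positivity) (fun x hx => by simp [hx]) hflat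
  have h2 : (2 : ℝ) / 2 = 1 := by norm_num
  rw [h2, one_mul] at h
  exact h

end Fibre

/-! ## §1b  The binder shape -/

section Binder

variable {P : Params} {k : ℕ} [DecidableEq (PBond P k)]

/-- ★★ **THE `hm` BINDER AGAINST THE WINDOW FORM**: «`∀ w′`, (reproduction on the region) `→ γ₀·circ(X) ≤ B_W w′ w′`», the shape `∀ w′, L♭ w′ = y → m ≤ Bf w′ w′` of the window skeleton
`B16Ineq17NearFlatWilsonLettersWindow.hessian_wilsonAction4_criticalExpChartFamily_ge_flatMin_sub_window` (`Bf := B_W`). [cite: Balaban1989LargeFieldII, (1.7) pp.357–358; Balaban1985Variational, (45) p.285] -/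
theorem hm_federbush_window_of_reproduce (h0 : 0 < P.d) (hk : k ≤ P.m + P.K) {S : Set (Site P k)} {T : Finset (PBond P k)}
    (X : GaugeSlice S T (EuclideanSpace ℝ (Fin 3))) {m : Fin P.d → ℕ} (lo : Fin P.d → ℤ) (hm : ∀ κ, (m κ : ℤ) ≤ P.sitesPerDir k)
    (Sset : (i : ℕ) → Finset (Site P i)) (hwin : ∀ z ∈ box m lo, (castSite z : Site P k) ∈ Sset k)
    (hS : ∀ (ν : Fin P.d), (⟨0, h0⟩ : Fin P.d) ≠ ν → ∀ i, i < k → ∀ y ∈ Sset (i + 1), ∀ (r : Fin P.d → Fin P.L) (s t : ℕ),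
      s < P.L → t < P.L → runSite (runSite (Site.blockSite y r) ⟨0, h0⟩ s) ν t ∈ Sset i)
    (Q : (i : ℕ) → (PBond P 0 → Matrix (Fin 2) (Fin 2) ℂ) → PBond P i → Matrix (Fin 2) (Fin 2) ℂ) (hQ0 : ∀ Y, Q 0 Y = Y)
    (hQs : ∀ (i : ℕ) (Y : PBond P 0 → Matrix (Fin 2) (Fin 2) ℂ) (c : PBond P (i + 1)), Q (i + 1) Y c = linAvg (Q i Y) c)
    {φ : EuclideanSpace ℝ (Fin 3) →ₗ[ℝ] lieSU (Fin 2)} (hφ : ∀ v, ((φ v : lieSU (Fin 2)) : Matrix (Fin 2) (Fin 2) ℂ) = quatMatrix (imQuat v))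
    (W : Finset (Plaq P 0)) (hW : ∀ q : Plaq P 0, q.src ∈ Sset 0 → q ∈ W) :
    ∀ w' : PBond P 0 → lieSU (Fin 2),
      (∀ (ν : Fin P.d), ∀ y ∈ Sset k,
        Q k (fun b => (w' b : Matrix (Fin 2) (Fin 2) ℂ)) ⟨y, ⟨0, h0⟩⟩ = ((φ (ιA S T X ⟨y, ⟨0, h0⟩⟩) : lieSU (Fin 2)) : Matrix (Fin 2) (Fin 2) ℂ) ∧
        Q k (fun b => (w' b : Matrix (Fin 2) (Fin 2) ℂ)) ⟨y.shift ⟨0, h0⟩, ν⟩ = ((φ (ιA S T X ⟨y.shift ⟨0, h0⟩, ν⟩) : lieSU (Fin 2)) : Matrix (Fin 2) (Fin 2) ℂ) ∧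
        Q k (fun b => (w' b : Matrix (Fin 2) (Fin 2) ℂ)) ⟨y.shift ν, ⟨0, h0⟩⟩ = ((φ (ιA S T X ⟨y.shift ν, ⟨0, h0⟩⟩) : lieSU (Fin 2)) : Matrix (Fin 2) (Fin 2) ℂ) ∧
        Q k (fun b => (w' b : Matrix (Fin 2) (Fin 2) ℂ)) ⟨y, ν⟩ = ((φ (ιA S T X ⟨y, ν⟩) : lieSU (Fin 2)) : Matrix (Fin 2) (Fin 2) ℂ)) →
      ((P.L : ℝ) ^ P.d) ^ k / (((P.L : ℝ)) ^ 2 * (P.L : ℝ) ^ 2) ^ k *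
          ∑ z ∈ box m lo, ∑ μ : Fin P.d, ∑ a : Fin 3, curl (fun b => ιA S T X (⟨castSite b.1, b.2⟩ : PBond P k) a) z ⟨0, h0⟩ μ ^ 2
        ≤ ((Fintype.card (Fin 2) : ℝ)⁻¹ • ∑ p ∈ W, (innerSL ℝ (E := lieSU (Fin 2))).bilinearComp
            (ContinuousLinearMap.proj (R := ℝ) (φ := fun _ : PBond P 0 => lieSU (Fin 2)) (⟨p.src, p.μ⟩ : PBond P 0) + ContinuousLinearMap.proj (R := ℝ) (φ := fun _ : PBond P 0 => lieSU (Fin 2)) (⟨p.src.shift p.μ, p.ν⟩ : PBond P 0)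
              - ContinuousLinearMap.proj (R := ℝ) (φ := fun _ : PBond P 0 => lieSU (Fin 2)) (⟨p.src.shift p.ν, p.μ⟩ : PBond P 0) - ContinuousLinearMap.proj (R := ℝ) (φ := fun _ : PBond P 0 => lieSU (Fin 2)) (⟨p.src, p.ν⟩ : PBond P 0) : (PBond P 0 → lieSU (Fin 2)) →L[ℝ] lieSU (Fin 2))
            (ContinuousLinearMap.proj (R := ℝ) (φ := fun _ : PBond P 0 => lieSU (Fin 2)) (⟨p.src, p.μ⟩ : PBond P 0) + ContinuousLinearMap.proj (R := ℝ) (φ := fun _ : PBond P 0 => lieSU (Fin 2)) (⟨p.src.shift p.μ, p.ν⟩ : PBond P 0)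
              - ContinuousLinearMap.proj (R := ℝ) (φ := fun _ : PBond P 0 => lieSU (Fin 2)) (⟨p.src.shift p.ν, p.μ⟩ : PBond P 0) - ContinuousLinearMap.proj (R := ℝ) (φ := fun _ : PBond P 0 => lieSU (Fin 2)) (⟨p.src, p.ν⟩ : PBond P 0) : (PBond P 0 → lieSU (Fin 2)) →L[ℝ] lieSU (Fin 2))
            : (PBond P 0 → lieSU (Fin 2)) →L[ℝ] (PBond P 0 → lieSU (Fin 2)) →L[ℝ] ℝ) w' w' :=
  fun w' hrep => gamma0_circ_le_flatFormOn_of_reproduce h0 hk X lo hm Sset hwin hS Q hQ0 hQs hφ W hW w' hrep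

end Binder

/-! ## §2  In chart currency and at the determining set of record -/

section Chart

variable {F : T4Family} {K k M₁ : ℕ} [DecidableEq (PBond (F.P K) k)]

/-- ★★ **FROM `DΦ♭(0) w′ = y` TO THE WINDOW BOUND** (p603788's `hm_federbush_of_fderiv_msChart_one_eq` twin): under the region dictionary `hcons` and the datum letter `hy`,
`∀ w′, DΦ♭(0) w′ = y → γ₀·circ(X) ≤ B_W w′ w′` for every `W ⊇ {q | q.src ∈ S_0}`. [cite: Balaban1989LargeFieldII, (1.7) pp.357–358; Balaban1985Variational, (44)–(48) p.285] -/
theorem hm_federbush_window_of_fderiv_msChart_one_eq (h0 : 0 < (F.P K).d) (hk : k ≤ (F.P K).m + (F.P K).K)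
    (Q : (i : ℕ) → (PBond (F.P K) 0 → Matrix (Fin 2) (Fin 2) ℂ) → PBond (F.P K) i → Matrix (Fin 2) (Fin 2) ℂ)
    (hQ0 : ∀ Y, Q 0 Y = Y) (hQs : ∀ (i : ℕ) (Y : PBond (F.P K) 0 → Matrix (Fin 2) (Fin 2) ℂ) (c : PBond (F.P K) (i + 1)), Q (i + 1) Y c = linAvg (Q i Y) c)
    (𝔹 : DetSet (F.P K)) {S : Set (Site (F.P K) k)} {T : Finset (PBond (F.P K) k)} (X : GaugeSlice S T (EuclideanSpace ℝ (Fin 3)))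
    {m : Fin (F.P K).d → ℕ} (lo : Fin (F.P K).d → ℤ) (hm : ∀ κ, (m κ : ℤ) ≤ (F.P K).sitesPerDir k)
    (Sset : (i : ℕ) → Finset (Site (F.P K) i)) (hwin : ∀ z ∈ box m lo, (castSite z : Site (F.P K) k) ∈ Sset k)
    (hS : ∀ (ν : Fin (F.P K).d), (⟨0, h0⟩ : Fin (F.P K).d) ≠ ν → ∀ i, i < k → ∀ y ∈ Sset (i + 1), ∀ (r : Fin (F.P K).d → Fin (F.P K).L) (s t : ℕ),
      s < (F.P K).L → t < (F.P K).L → runSite (runSite (Site.blockSite y r) ⟨0, h0⟩ s) ν t ∈ Sset i)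
    {φ : EuclideanSpace ℝ (Fin 3) →ₗ[ℝ] lieSU (Fin 2)} (hφ : ∀ v, ((φ v : lieSU (Fin 2)) : Matrix (Fin 2) (Fin 2) ℂ) = quatMatrix (imQuat v))
    (W : Finset (Plaq (F.P K) 0)) (hW : ∀ q : Plaq (F.P K) 0, q.src ∈ Sset 0 → q ∈ W)
    (hcons : ∀ (ν : Fin (F.P K).d), ∀ s ∈ Sset k, (⟨s, ⟨0, h0⟩⟩ : PBond (F.P K) k) ∈ bondsOf (𝔹 k) ∧ (⟨s.shift ⟨0, h0⟩, ν⟩ : PBond (F.P K) k) ∈ bondsOf (𝔹 k) ∧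
      (⟨s.shift ν, ⟨0, h0⟩⟩ : PBond (F.P K) k) ∈ bondsOf (𝔹 k) ∧ (⟨s, ν⟩ : PBond (F.P K) k) ∈ bondsOf (𝔹 k))
    {y : Fin (constrCard 𝔹 k) → lieSU (Fin 2)}
    (hy : ∀ (b : PBond (F.P K) k) (hb : b ∈ bondsOf (𝔹 k)), y (constrEnum 𝔹 k ⟨Fin.last k, ⟨b, hb⟩⟩) = φ (ιA S T X b)) :
    ∀ w' : PBond (F.P K) 0 → lieSU (Fin 2),
      fderiv ℝ (msChart F 2 K k 𝔹 (avgFamily (avOfRecord F 2 K) (1 : GaugeField (F.P K) 0 (SU 2))) (1 : GaugeField (F.P K) 0 (SU 2))) 0 w' = y →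
      (((F.P K).L : ℝ) ^ (F.P K).d) ^ k / ((((F.P K).L : ℝ)) ^ 2 * ((F.P K).L : ℝ) ^ 2) ^ k *
          ∑ z ∈ box m lo, ∑ μ : Fin (F.P K).d, ∑ a : Fin 3, curl (fun b => ιA S T X (⟨castSite b.1, b.2⟩ : PBond (F.P K) k) a) z ⟨0, h0⟩ μ ^ 2
        ≤ ((Fintype.card (Fin 2) : ℝ)⁻¹ • ∑ p ∈ W, (innerSL ℝ (E := lieSU (Fin 2))).bilinearComp
            (ContinuousLinearMap.proj (R := ℝ) (φ := fun _ : PBond (F.P K) 0 => lieSU (Fin 2)) (⟨p.src, p.μ⟩ : PBond (F.P K) 0) + ContinuousLinearMap.proj (R := ℝ) (φ := fun _ : PBond (F.P K) 0 => lieSU (Fin 2)) (⟨p.src.shift p.μ, p.ν⟩ : PBond (F.P K) 0)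
              - ContinuousLinearMap.proj (R := ℝ) (φ := fun _ : PBond (F.P K) 0 => lieSU (Fin 2)) (⟨p.src.shift p.ν, p.μ⟩ : PBond (F.P K) 0) - ContinuousLinearMap.proj (R := ℝ) (φ := fun _ : PBond (F.P K) 0 => lieSU (Fin 2)) (⟨p.src, p.ν⟩ : PBond (F.P K) 0) : (PBond (F.P K) 0 → lieSU (Fin 2)) →L[ℝ] lieSU (Fin 2))
            (ContinuousLinearMap.proj (R := ℝ) (φ := fun _ : PBond (F.P K) 0 => lieSU (Fin 2)) (⟨p.src, p.μ⟩ : PBond (F.P K) 0) + ContinuousLinearMap.proj (R := ℝ) (φ := fun _ : PBond (F.P K) 0 => lieSU (Fin 2)) (⟨p.src.shift p.μ, p.ν⟩ : PBond (F.P K) 0)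
              - ContinuousLinearMap.proj (R := ℝ) (φ := fun _ : PBond (F.P K) 0 => lieSU (Fin 2)) (⟨p.src.shift p.ν, p.μ⟩ : PBond (F.P K) 0) - ContinuousLinearMap.proj (R := ℝ) (φ := fun _ : PBond (F.P K) 0 => lieSU (Fin 2)) (⟨p.src, p.ν⟩ : PBond (F.P K) 0) : (PBond (F.P K) 0 → lieSU (Fin 2)) →L[ℝ] lieSU (Fin 2))
            : (PBond (F.P K) 0 → lieSU (Fin 2)) →L[ℝ] (PBond (F.P K) 0 → lieSU (Fin 2)) →L[ℝ] ℝ) w' w' :=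
  fun w' hD => gamma0_circ_le_flatFormOn_of_reproduce h0 hk X lo hm Sset hwin hS Q hQ0 hQs hφ W hW w'
    (reproduce_of_fderiv_msChart_one_eq h0 Q hQ0 hQs 𝔹 X (Sset k) hcons hy w' hD)

/-- ★★ **AT THE DETERMINING SET OF RECORD `𝐁_k(Z)`** (p604917's twin: `hcons` replaced by the placement letter `hΩk`). [cite: Balaban1989LargeFieldII, (1.7) pp.357–358; Balaban1989LargeFieldI, (1.74) p.192, Prop. 1 p.194; Balaban1988Convergent, (2.13) pp.256–257] -/
theorem hm_federbush_window_atBj_of_fderiv_msChart_one_eq (h0 : 0 < (F.P K).d) (hk : k ≤ (F.P K).m + (F.P K).K)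
    (Q : (i : ℕ) → (PBond (F.P K) 0 → Matrix (Fin 2) (Fin 2) ℂ) → PBond (F.P K) i → Matrix (Fin 2) (Fin 2) ℂ)
    (hQ0 : ∀ Y, Q 0 Y = Y) (hQs : ∀ (i : ℕ) (Y : PBond (F.P K) 0 → Matrix (Fin 2) (Fin 2) ℂ) (c : PBond (F.P K) (i + 1)), Q (i + 1) Y c = linAvg (Q i Y) c)
    (Z : Set (Site (F.P K) 0)) {S : Set (Site (F.P K) k)} {T : Finset (PBond (F.P K) k)} (X : GaugeSlice S T (EuclideanSpace ℝ (Fin 3)))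
    {m : Fin (F.P K).d → ℕ} (lo : Fin (F.P K).d → ℤ) (hm : ∀ κ, (m κ : ℤ) ≤ (F.P K).sitesPerDir k)
    (Sset : (i : ℕ) → Finset (Site (F.P K) i)) (hwin : ∀ z ∈ box m lo, (castSite z : Site (F.P K) k) ∈ Sset k)
    (hS : ∀ (ν : Fin (F.P K).d), (⟨0, h0⟩ : Fin (F.P K).d) ≠ ν → ∀ i, i < k → ∀ y ∈ Sset (i + 1), ∀ (r : Fin (F.P K).d → Fin (F.P K).L) (s t : ℕ),
      s < (F.P K).L → t < (F.P K).L → runSite (runSite (Site.blockSite y r) ⟨0, h0⟩ s) ν t ∈ Sset i)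
    {φ : EuclideanSpace ℝ (Fin 3) →ₗ[ℝ] lieSU (Fin 2)} (hφ : ∀ v, ((φ v : lieSU (Fin 2)) : Matrix (Fin 2) (Fin 2) ℂ) = quatMatrix (imQuat v))
    (W : Finset (Plaq (F.P K) 0)) (hW : ∀ q : Plaq (F.P K) 0, q.src ∈ Sset 0 → q ∈ W)
    (hΩk : ∀ (ν : Fin (F.P K).d), ∀ s ∈ Sset k, s ∈ pts k (maxDomT M₁ Z k) ∧ s.shift ⟨0, h0⟩ ∈ pts k (maxDomT M₁ Z k) ∧ s.shift ν ∈ pts k (maxDomT M₁ Z k))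
    {y : Fin (constrCard (Bj M₁ Z k) k) → lieSU (Fin 2)}
    (hy : ∀ (b : PBond (F.P K) k) (hb : b ∈ bondsOf (Bj M₁ Z k k)), y (constrEnum (Bj M₁ Z k) k ⟨Fin.last k, ⟨b, hb⟩⟩) = φ (ιA S T X b)) :
    ∀ w' : PBond (F.P K) 0 → lieSU (Fin 2),
      fderiv ℝ (msChart F 2 K k (Bj M₁ Z k) (avgFamily (avOfRecord F 2 K) (1 : GaugeField (F.P K) 0 (SU 2))) (1 : GaugeField (F.P K) 0 (SU 2))) 0 w' = y →
      (((F.P K).L : ℝ) ^ (F.P K).d) ^ k / ((((F.P K).L : ℝ)) ^ 2 * ((F.P K).L : ℝ) ^ 2) ^ k *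
          ∑ z ∈ box m lo, ∑ μ : Fin (F.P K).d, ∑ a : Fin 3, curl (fun b => ιA S T X (⟨castSite b.1, b.2⟩ : PBond (F.P K) k) a) z ⟨0, h0⟩ μ ^ 2
        ≤ ((Fintype.card (Fin 2) : ℝ)⁻¹ • ∑ p ∈ W, (innerSL ℝ (E := lieSU (Fin 2))).bilinearComp
            (ContinuousLinearMap.proj (R := ℝ) (φ := fun _ : PBond (F.P K) 0 => lieSU (Fin 2)) (⟨p.src, p.μ⟩ : PBond (F.P K) 0) + ContinuousLinearMap.proj (R := ℝ) (φ := fun _ : PBond (F.P K) 0 => lieSU (Fin 2)) (⟨p.src.shift p.μ, p.ν⟩ : PBond (F.P K) 0)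
              - ContinuousLinearMap.proj (R := ℝ) (φ := fun _ : PBond (F.P K) 0 => lieSU (Fin 2)) (⟨p.src.shift p.ν, p.μ⟩ : PBond (F.P K) 0) - ContinuousLinearMap.proj (R := ℝ) (φ := fun _ : PBond (F.P K) 0 => lieSU (Fin 2)) (⟨p.src, p.ν⟩ : PBond (F.P K) 0) : (PBond (F.P K) 0 → lieSU (Fin 2)) →L[ℝ] lieSU (Fin 2))
            (ContinuousLinearMap.proj (R := ℝ) (φ := fun _ : PBond (F.P K) 0 => lieSU (Fin 2)) (⟨p.src, p.μ⟩ : PBond (F.P K) 0) + ContinuousLinearMap.proj (R := ℝ) (φ := fun _ : PBond (F.P K) 0 => lieSU (Fin 2)) (⟨p.src.shift p.μ, p.ν⟩ : PBond (F.P K) 0)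
              - ContinuousLinearMap.proj (R := ℝ) (φ := fun _ : PBond (F.P K) 0 => lieSU (Fin 2)) (⟨p.src.shift p.ν, p.μ⟩ : PBond (F.P K) 0) - ContinuousLinearMap.proj (R := ℝ) (φ := fun _ : PBond (F.P K) 0 => lieSU (Fin 2)) (⟨p.src, p.ν⟩ : PBond (F.P K) 0) : (PBond (F.P K) 0 → lieSU (Fin 2)) →L[ℝ] lieSU (Fin 2))
            : (PBond (F.P K) 0 → lieSU (Fin 2)) →L[ℝ] (PBond (F.P K) 0 → lieSU (Fin 2)) →L[ℝ] ℝ) w' w' :=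
  hm_federbush_window_of_fderiv_msChart_one_eq h0 hk Q hQ0 hQs (Bj M₁ Z k) X lo hm Sset hwin hS hφ W hW (hcons_of_plaqsInside_maxDomT h0 Z (Sset k) hΩk) hy

end Chart

/-! ## §3  At the curved chart of record, through the twist -/

section Twisted

variable {F : T4Family} {K k M₁ : ℕ}

/-- ★★★ **THE FEDERBUSH FIBRE LETTER AT THE CURVED CHART OF RECORD, AGAINST THE WINDOW FORM** (p611770 §3 twin; twist size `hW′`): for every fine `w′` with
`DΦ♭(0)w′ = DΨ(0)(X_f′X)`, `((L^d)^k∕(L²L²)^k)·(circ(X) − 16(d+1)τ‖X‖²) ≤ B_W w′ w′` — (β3) identifies the top components of the curved datum velocity with the twisted slice vector `X̃`,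
§2 at `X̃`, (T) returns to `circ X`. [cite: Balaban1989LargeFieldII, (1.7) pp.357–358, (1.12) p.359, (1.19) p.360; Balaban1989LargeFieldI, (1.74) p.192, Prop. 1 p.194; Balaban1988Convergent, (2.10)–(2.13) pp.256–257; Balaban1985Variational, (45) p.285, (82)–(83) p.290] -/
theorem hm_federbush_atBj_twisted_window_of_isMinimizer_family (h0 : 0 < (F.P K).d) (hk : k ≤ (F.P K).m + (F.P K).K)
    (Q : (i : ℕ) → (PBond (F.P K) 0 → Matrix (Fin 2) (Fin 2) ℂ) → PBond (F.P K) i → Matrix (Fin 2) (Fin 2) ℂ)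
    (hQ0 : ∀ Y, Q 0 Y = Y) (hQs : ∀ (i : ℕ) (Y : PBond (F.P K) 0 → Matrix (Fin 2) (Fin 2) ℂ) (c : PBond (F.P K) (i + 1)), Q (i + 1) Y c = linAvg (Q i Y) c)
    (Z : Set (Site (F.P K) 0)) {S : Set (Site (F.P K) k)} {T : Finset (PBond (F.P K) k)} (X : GaugeSlice S T (EuclideanSpace ℝ (Fin 3)))
    {m : Fin (F.P K).d → ℕ} (lo : Fin (F.P K).d → ℤ) (hm : ∀ κ, (m κ : ℤ) ≤ (F.P K).sitesPerDir k)
    (Sset : (i : ℕ) → Finset (Site (F.P K) i)) (hwin : ∀ z ∈ box m lo, (castSite z : Site (F.P K) k) ∈ Sset k)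
    (hS : ∀ (ν : Fin (F.P K).d), (⟨0, h0⟩ : Fin (F.P K).d) ≠ ν → ∀ i, i < k → ∀ y ∈ Sset (i + 1), ∀ (r : Fin (F.P K).d → Fin (F.P K).L) (s t : ℕ),
      s < (F.P K).L → t < (F.P K).L → runSite (runSite (Site.blockSite y r) ⟨0, h0⟩ s) ν t ∈ Sset i)
    {φ : EuclideanSpace ℝ (Fin 3) →ₗ[ℝ] lieSU (Fin 2)} (hφ : ∀ v, ((φ v : lieSU (Fin 2)) : Matrix (Fin 2) (Fin 2) ℂ) = quatMatrix (imQuat v))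
    (W : Finset (Plaq (F.P K) 0)) (hW : ∀ q : Plaq (F.P K) 0, q.src ∈ Sset 0 → q ∈ W)
    (hΩk : ∀ (ν : Fin (F.P K).d), ∀ s ∈ Sset k, s ∈ pts k (maxDomT M₁ Z k) ∧ s.shift ⟨0, h0⟩ ∈ pts k (maxDomT M₁ Z k) ∧ s.shift ν ∈ pts k (maxDomT M₁ Z k))
    -- the (K′) family of the lane owner's package at the datum `M˙(Q_k^{s*}V)`, and the chart's differentiability at `0`
    (reg : Set (GaugeField (F.P K) 0 (SU 2))) (V : GaugeField (F.P K) k (SU 2)) (U₀ : GaugeField (F.P K) 0 (SU 2))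
    {Xf : GaugeSlice S T (EuclideanSpace ℝ (Fin 3)) → PBond (F.P K) 0 → lieSU (Fin 2)} (hX₀ : Xf 0 = 0)
    (hmin : ∀ᶠ Y in 𝓝 (0 : GaugeSlice S T (EuclideanSpace ℝ (Fin 3))),
      IsMinimizer (avOfRecord F 2 K) reg (Bj M₁ Z k) (avgFamily (avOfRecord F 2 K) (qsstarGIter0 k (expMul su2Chart (ιA S T Y) V))) (expChart U₀ (Xf Y)))
    {X' : GaugeSlice S T (EuclideanSpace ℝ (Fin 3)) →L[ℝ] PBond (F.P K) 0 → lieSU (Fin 2)} (hX : HasFDerivAt Xf X' 0)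
    (hΨ : DifferentiableAt ℝ (msChart F 2 K k (Bj M₁ Z k) (avgFamily (avOfRecord F 2 K) (qsstarGIter0 k V)) U₀) 0)
    -- the twist size at the level-`k` constrained bonds
    {τ : ℝ} (hτ : 0 < τ)
    (hW' : ∀ c ∈ bondsOf (Bj M₁ Z k k), ‖((avgFamily (avOfRecord F 2 K) (qsstarGIter0 k V) k c : SU 2) : Matrix (Fin 2) (Fin 2) ℂ) - 1‖ ≤ τ / 2) :
    ∀ w' : PBond (F.P K) 0 → lieSU (Fin 2),
      fderiv ℝ (msChart F 2 K k (Bj M₁ Z k) (avgFamily (avOfRecord F 2 K) (1 : GaugeField (F.P K) 0 (SU 2))) (1 : GaugeField (F.P K) 0 (SU 2))) 0 w'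
          = fderiv ℝ (msChart F 2 K k (Bj M₁ Z k) (avgFamily (avOfRecord F 2 K) (qsstarGIter0 k V)) U₀) 0 (X' X) →
      (((F.P K).L : ℝ) ^ (F.P K).d) ^ k / ((((F.P K).L : ℝ)) ^ 2 * ((F.P K).L : ℝ) ^ 2) ^ k *
          ((∑ z ∈ box m lo, ∑ μ : Fin (F.P K).d, ∑ a : Fin 3, curl (fun b => ιA S T X (⟨castSite b.1, b.2⟩ : PBond (F.P K) k) a) z ⟨0, h0⟩ μ ^ 2)
            - 16 * (((F.P K).d : ℝ) + 1) * τ * ‖X‖ ^ 2)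
        ≤ ((Fintype.card (Fin 2) : ℝ)⁻¹ • ∑ p ∈ W, (innerSL ℝ (E := lieSU (Fin 2))).bilinearComp
            (ContinuousLinearMap.proj (R := ℝ) (φ := fun _ : PBond (F.P K) 0 => lieSU (Fin 2)) (⟨p.src, p.μ⟩ : PBond (F.P K) 0) + ContinuousLinearMap.proj (R := ℝ) (φ := fun _ : PBond (F.P K) 0 => lieSU (Fin 2)) (⟨p.src.shift p.μ, p.ν⟩ : PBond (F.P K) 0)
              - ContinuousLinearMap.proj (R := ℝ) (φ := fun _ : PBond (F.P K) 0 => lieSU (Fin 2)) (⟨p.src.shift p.ν, p.μ⟩ : PBond (F.P K) 0) - ContinuousLinearMap.proj (R := ℝ) (φ := fun _ : PBond (F.P K) 0 => lieSU (Fin 2)) (⟨p.src, p.ν⟩ : PBond (F.P K) 0) : (PBond (F.P K) 0 → lieSU (Fin 2)) →L[ℝ] lieSU (Fin 2))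
            (ContinuousLinearMap.proj (R := ℝ) (φ := fun _ : PBond (F.P K) 0 => lieSU (Fin 2)) (⟨p.src, p.μ⟩ : PBond (F.P K) 0) + ContinuousLinearMap.proj (R := ℝ) (φ := fun _ : PBond (F.P K) 0 => lieSU (Fin 2)) (⟨p.src.shift p.μ, p.ν⟩ : PBond (F.P K) 0)
              - ContinuousLinearMap.proj (R := ℝ) (φ := fun _ : PBond (F.P K) 0 => lieSU (Fin 2)) (⟨p.src.shift p.ν, p.μ⟩ : PBond (F.P K) 0) - ContinuousLinearMap.proj (R := ℝ) (φ := fun _ : PBond (F.P K) 0 => lieSU (Fin 2)) (⟨p.src, p.ν⟩ : PBond (F.P K) 0) : (PBond (F.P K) 0 → lieSU (Fin 2)) →L[ℝ] lieSU (Fin 2))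
            : (PBond (F.P K) 0 → lieSU (Fin 2)) →L[ℝ] (PBond (F.P K) 0 → lieSU (Fin 2)) →L[ℝ] ℝ) w' w' := by
  classical
  intro w' hw'
  set Wm : MSField (F.P K) (SU 2) := avgFamily (avOfRecord F 2 K) (qsstarGIter0 k V) with hWdef
  -- §1: the rotations; the bond-wise twist `R_b := ρ(W_k(b))` at the constrained bonds, the identity elsewhere
  obtain ⟨ρ, hρφ, hρn⟩ := exists_rotE3_of_lieSU2Coord hφ
  let R : PBond (F.P K) k → EuclideanSpace ℝ (Fin 3) →ₗ[ℝ] EuclideanSpace ℝ (Fin 3) := fun b =>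
    if b ∈ bondsOf (Bj M₁ Z k k) then ρ (Wm k b) else LinearMap.id
  have hRn : ∀ b v, ‖R b v - v‖ ≤ τ * ‖v‖ := by
    intro b v
    by_cases hb : b ∈ bondsOf (Bj M₁ Z k k)
    · have h1 : R b = ρ (Wm k b) := if_pos hb
      rw [h1]
      calc ‖ρ (Wm k b) v - v‖ ≤ 2 * ‖((Wm k b : SU 2) : Matrix (Fin 2) (Fin 2) ℂ) - 1‖ * ‖v‖ := hρn _ _
        _ ≤ 2 * (τ / 2) * ‖v‖ := by gcongr; exact hW' b hb
        _ = τ * ‖v‖ := by ring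
    · have h1 : R b = LinearMap.id := if_neg hb
      rw [h1, LinearMap.id_apply, sub_self, norm_zero]
      positivity
  -- §2: the twisted slice vector
  obtain ⟨Xt, hXt⟩ := exists_twistSlice X R
  have hclose : ∀ b, ‖ιA S T Xt b - ιA S T X b‖ ≤ τ * ‖ιA S T X b‖ := twistSlice_close hXt hRn
  -- (β3): the top components of the curved datum velocity are the twisted coordinates
  have hΨ' : DifferentiableAt ℝ (msChart F 2 K k (Bj M₁ Z k) Wm U₀) (Xf 0) := by rw [hX₀]; exact hΨ
  have hy : ∀ (b : PBond (F.P K) k) (hb : b ∈ bondsOf (Bj M₁ Z k k)),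
      fderiv ℝ (msChart F 2 K k (Bj M₁ Z k) Wm U₀) 0 (X' X) (constrEnum (Bj M₁ Z k) k ⟨Fin.last k, ⟨b, hb⟩⟩) = φ (ιA S T Xt b) := by
    intro b hb
    have h := fderiv_msChart_comp_apply_top_of_isMinimizer_family S T hk hφ (Bj M₁ Z k) reg V U₀ hmin hX hΨ' X b hb
    rw [hX₀] at h
    rw [h, hXt b, ← hρφ]
    congr 1
    show ρ (Wm k b) (ιA S T X b) = R b (ιA S T X b)
    have h1 : R b = ρ (Wm k b) := if_pos hb
    rw [h1]
  -- p604917 at the twisted slice vector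
  have hflat := hm_federbush_window_atBj_of_fderiv_msChart_one_eq (M₁ := M₁) h0 hk Q hQ0 hQs Z Xt lo hm Sset hwin hS hφ W hW hΩk
    (y := fderiv ℝ (msChart F 2 K k (Bj M₁ Z k) Wm U₀) 0 (X' X)) hy w' hw'
  -- (T): return to `circ X`
  have htwist := circ_twist_ge_sub h0 X Xt hτ hclose lo hm
  have hratio : 0 ≤ (((F.P K).L : ℝ) ^ (F.P K).d) ^ k / ((((F.P K).L : ℝ)) ^ 2 * ((F.P K).L : ℝ) ^ 2) ^ k := by positivity
  exact (mul_le_mul_of_nonneg_left htwist hratio).trans hflat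

/-- ★★ **THE J-C CLAUSE AGAINST THE WINDOW FORM**: `∃ m, (∀ w′, Lf w′ = DΨ(0)(X_f′X) → m ≤ B_W w′ w′) ∧ γ₀·circ(X) − γ₀·16(d+1)τ‖X‖² ≤ m` — the shape the window skeleton's `hm` and
dag-n12-c's junction `B15Prop1EndpointNearFlatLettersWindow` read (region letters displayed; the knit discharge is the sequel). [cite: Balaban1989LargeFieldII, (1.7) pp.357–358, (1.12) p.359; Balaban1989LargeFieldI, Prop. 1 p.194] -/
theorem exists_m_hm_twisted_windowForm_of_isMinimizer_family (h0 : 0 < (F.P K).d) (hk : k ≤ (F.P K).m + (F.P K).K)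
    (Q : (i : ℕ) → (PBond (F.P K) 0 → Matrix (Fin 2) (Fin 2) ℂ) → PBond (F.P K) i → Matrix (Fin 2) (Fin 2) ℂ)
    (hQ0 : ∀ Y, Q 0 Y = Y) (hQs : ∀ (i : ℕ) (Y : PBond (F.P K) 0 → Matrix (Fin 2) (Fin 2) ℂ) (c : PBond (F.P K) (i + 1)), Q (i + 1) Y c = linAvg (Q i Y) c)
    (Z : Set (Site (F.P K) 0)) {S : Set (Site (F.P K) k)} {T : Finset (PBond (F.P K) k)} (X : GaugeSlice S T (EuclideanSpace ℝ (Fin 3)))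
    {m : Fin (F.P K).d → ℕ} (lo : Fin (F.P K).d → ℤ) (hm : ∀ κ, (m κ : ℤ) ≤ (F.P K).sitesPerDir k)
    (Sset : (i : ℕ) → Finset (Site (F.P K) i)) (hwin : ∀ z ∈ box m lo, (castSite z : Site (F.P K) k) ∈ Sset k)
    (hS : ∀ (ν : Fin (F.P K).d), (⟨0, h0⟩ : Fin (F.P K).d) ≠ ν → ∀ i, i < k → ∀ y ∈ Sset (i + 1), ∀ (r : Fin (F.P K).d → Fin (F.P K).L) (s t : ℕ),
      s < (F.P K).L → t < (F.P K).L → runSite (runSite (Site.blockSite y r) ⟨0, h0⟩ s) ν t ∈ Sset i)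
    {φ : EuclideanSpace ℝ (Fin 3) →ₗ[ℝ] lieSU (Fin 2)} (hφ : ∀ v, ((φ v : lieSU (Fin 2)) : Matrix (Fin 2) (Fin 2) ℂ) = quatMatrix (imQuat v))
    (W : Finset (Plaq (F.P K) 0)) (hW : ∀ q : Plaq (F.P K) 0, q.src ∈ Sset 0 → q ∈ W)
    (hΩk : ∀ (ν : Fin (F.P K).d), ∀ s ∈ Sset k, s ∈ pts k (maxDomT M₁ Z k) ∧ s.shift ⟨0, h0⟩ ∈ pts k (maxDomT M₁ Z k) ∧ s.shift ν ∈ pts k (maxDomT M₁ Z k))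
    (reg : Set (GaugeField (F.P K) 0 (SU 2))) (V : GaugeField (F.P K) k (SU 2)) (U₀ : GaugeField (F.P K) 0 (SU 2))
    {Xf : GaugeSlice S T (EuclideanSpace ℝ (Fin 3)) → PBond (F.P K) 0 → lieSU (Fin 2)} (hX₀ : Xf 0 = 0)
    (hmin : ∀ᶠ Y in 𝓝 (0 : GaugeSlice S T (EuclideanSpace ℝ (Fin 3))),
      IsMinimizer (avOfRecord F 2 K) reg (Bj M₁ Z k) (avgFamily (avOfRecord F 2 K) (qsstarGIter0 k (expMul su2Chart (ιA S T Y) V))) (expChart U₀ (Xf Y)))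
    {X' : GaugeSlice S T (EuclideanSpace ℝ (Fin 3)) →L[ℝ] PBond (F.P K) 0 → lieSU (Fin 2)} (hX : HasFDerivAt Xf X' 0)
    (hΨ : DifferentiableAt ℝ (msChart F 2 K k (Bj M₁ Z k) (avgFamily (avOfRecord F 2 K) (qsstarGIter0 k V)) U₀) 0)
    {τ : ℝ} (hτ : 0 < τ)
    (hW' : ∀ c ∈ bondsOf (Bj M₁ Z k k), ‖((avgFamily (avOfRecord F 2 K) (qsstarGIter0 k V) k c : SU 2) : Matrix (Fin 2) (Fin 2) ℂ) - 1‖ ≤ τ / 2) :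
    ∃ m' : ℝ,
      (∀ w' : PBond (F.P K) 0 → lieSU (Fin 2),
        fderiv ℝ (msChart F 2 K k (Bj M₁ Z k) (avgFamily (avOfRecord F 2 K) (1 : GaugeField (F.P K) 0 (SU 2))) (1 : GaugeField (F.P K) 0 (SU 2))) 0 w'
            = fderiv ℝ (msChart F 2 K k (Bj M₁ Z k) (avgFamily (avOfRecord F 2 K) (qsstarGIter0 k V)) U₀) 0 (X' X) →
        m' ≤ ((Fintype.card (Fin 2) : ℝ)⁻¹ • ∑ p ∈ W, (innerSL ℝ (E := lieSU (Fin 2))).bilinearComp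
              (ContinuousLinearMap.proj (R := ℝ) (φ := fun _ : PBond (F.P K) 0 => lieSU (Fin 2)) (⟨p.src, p.μ⟩ : PBond (F.P K) 0) + ContinuousLinearMap.proj (R := ℝ) (φ := fun _ : PBond (F.P K) 0 => lieSU (Fin 2)) (⟨p.src.shift p.μ, p.ν⟩ : PBond (F.P K) 0)
                - ContinuousLinearMap.proj (R := ℝ) (φ := fun _ : PBond (F.P K) 0 => lieSU (Fin 2)) (⟨p.src.shift p.ν, p.μ⟩ : PBond (F.P K) 0) - ContinuousLinearMap.proj (R := ℝ) (φ := fun _ : PBond (F.P K) 0 => lieSU (Fin 2)) (⟨p.src, p.ν⟩ : PBond (F.P K) 0) : (PBond (F.P K) 0 → lieSU (Fin 2)) →L[ℝ] lieSU (Fin 2))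
              (ContinuousLinearMap.proj (R := ℝ) (φ := fun _ : PBond (F.P K) 0 => lieSU (Fin 2)) (⟨p.src, p.μ⟩ : PBond (F.P K) 0) + ContinuousLinearMap.proj (R := ℝ) (φ := fun _ : PBond (F.P K) 0 => lieSU (Fin 2)) (⟨p.src.shift p.μ, p.ν⟩ : PBond (F.P K) 0)
                - ContinuousLinearMap.proj (R := ℝ) (φ := fun _ : PBond (F.P K) 0 => lieSU (Fin 2)) (⟨p.src.shift p.ν, p.μ⟩ : PBond (F.P K) 0) - ContinuousLinearMap.proj (R := ℝ) (φ := fun _ : PBond (F.P K) 0 => lieSU (Fin 2)) (⟨p.src, p.ν⟩ : PBond (F.P K) 0) : (PBond (F.P K) 0 → lieSU (Fin 2)) →L[ℝ] lieSU (Fin 2))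
              : (PBond (F.P K) 0 → lieSU (Fin 2)) →L[ℝ] (PBond (F.P K) 0 → lieSU (Fin 2)) →L[ℝ] ℝ) w' w') ∧
      (((F.P K).L : ℝ) ^ (F.P K).d) ^ k / ((((F.P K).L : ℝ)) ^ 2 * ((F.P K).L : ℝ) ^ 2) ^ k *
            (∑ z ∈ box m lo, ∑ μ : Fin (F.P K).d, ∑ a : Fin 3, curl (fun b => ιA S T X (⟨castSite b.1, b.2⟩ : PBond (F.P K) k) a) z ⟨0, h0⟩ μ ^ 2)
          - (((F.P K).L : ℝ) ^ (F.P K).d) ^ k / ((((F.P K).L : ℝ)) ^ 2 * ((F.P K).L : ℝ) ^ 2) ^ k * (16 * (((F.P K).d : ℝ) + 1) * τ) * ‖X‖ ^ 2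
        ≤ m' := by
  refine ⟨_, hm_federbush_atBj_twisted_window_of_isMinimizer_family h0 hk Q hQ0 hQs Z X lo hm Sset hwin hS hφ W hW hΩk reg V U₀ hX₀ hmin hX hΨ hτ hW', le_of_eq ?_⟩
  ring

end Twisted

end Summit.QuantumFields.YangMills.BalabanUVNodes.N12NearFlatFederbushFibreWindow

end
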